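import Mathlib
import HarnessLib

/-!
# The Ford–Green–Konyagin–Maynard–Tao probabilistic covering theorem (generalised
# Pippenger–Spencer / Rödl nibble with reweighting) — STATEMENT

Topic `Literature/Combinatorics/Hypergraph`. Source: K. Ford, B. Green, S. Konyagin, J. Maynard,
T. Tao, *Long gaps between primes*, J. Amer. Math. Soc. 31 (2018) 65–105 = arXiv:1412.5029, §4.2
«Statement of covering theorem», Theorem 3 (Probabilistic covering) and Corollary 1 (Combinatorial
covering) [FordGreenKonyaginMaynardTao2018]. The theorem generalises the hypergraph covering theorem
of Pippenger–Spencer [PippengerSpencer1989] (Rödl nibble): hypothesis (ii) «the hypergraphs do not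
depend on `i`» is eliminated and (i) «`d_I(v) ≈ d`», (iv) «edges of constant size» are weakened, by
REWEIGHTING the semi-random selection at each nibble (§5 of the paper).

This file TYPES Theorem 3 exactly as printed («completely quantitative, avoiding asymptotic
notation»). Nothing is proved here: `FGKMT2018_theorem3` is a NAMED FACT (`def … : Prop`) to be
used as a hypothesis `(h : FGKMT2018_theorem3)`; its proof (§5, induction on the number `m` of
nibbles, ≈ 8 printed pages of finite probability) is a kernel target of the Parity large-gaps ladder.

RENDERING OF THE PROBABILITY. All randomness is finite, so random objects are replaced by their
LAWS (mass functions), as in `Literature.NumberTheory.Sieve.Maynard2016ProbabilisticMethod`: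
* the vertex set is a finite type `V`, the index set a finite type `ι`, and the «disjoint finite
  non-empty sets `I_1, …, I_m`» are `I : ℕ → Finset ι` restricted to `j ∈ [1, m]` (pairwise disjoint,
  non-empty); indices outside `⋃_j I_j` are inert;
* «a random finite subset `𝐞_i` of `V`» enters the HYPOTHESES (4.6)–(4.12) only through its own law,
  so it is a mass function `μ i : Finset V → ℝ` (`IsLaw`: nonnegative, total mass `1`), with
  `P(v ∈ 𝐞_i) = probMem (μ i) v`, `P(v₁, v₂ ∈ 𝐞_i) = probPairMem (μ i) v₁ v₂`, and «almost surely
  `#𝐞_i ≤ r`» = every set of positive mass has `≤ r` elements;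
* the CONCLUSION produces jointly distributed `𝐞'_i`; they are a joint law `Λ` on configurations
  `ω : ι → Finset V` (the `𝐞'_i` are the coordinate projections of the finite probability space
  `(ι → Finset V, Λ)`), (a) «the essential support of `𝐞'_i` is contained in that of `𝐞_i` union
  `{∅}`» = every configuration of positive `Λ`-mass has `ω i = ∅ ∨ μ i (ω i) ≠ 0`, and (b) the
  probability of the event «`e ⊆ V ∖ ⋃_{j ≤ J} ⋃_{i ∈ I_j} 𝐞'_i`» is the `Λ`-mass of the
  configurations `ω` with `v ∉ ω i` for all `v ∈ e`, `j ∈ [1, J]`, `i ∈ I_j`;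
* `X = (1 + O_≤(ε)) Y` means `|X − Y| ≤ ε Y` (here `Y = P_J(e) > 0`).
The parameters `D, r, A ≥ 1` are real, `κ ∈ (0, 1/2]`, `m ∈ ℕ`, `δ > 0`; `κ^A` is the real power.

## Main statements

* `FGKMTCovering.probMem`, `probPairMem`, `normDegree` (`d_I(v)`, (4.9)), `levelProb` (`P_j(v)`,
  (4.10)–(4.11)), `levelProbSet` (`P_j(e)`, (4.14)), `IsLaw`;
* `FGKMTCovering.Theorem3With C₀` : the body of Theorem 3 for a given absolute constant `C₀`;
* `FGKMT2018_theorem3 : Prop` : **Theorem 3** («there exists a constant `C₀ ≥ 1` such that …»).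

## References

* K. Ford, B. Green, S. Konyagin, J. Maynard, T. Tao, *Long gaps between primes*, J. Amer. Math.
  Soc. 31 (2018) 65–105, §4.2, Theorem 3, (4.5)–(4.14). [FordGreenKonyaginMaynardTao2018]
* N. Pippenger, J. Spencer, *Asymptotic behavior of the chromatic index for hypergraphs*, J. Combin.
  Theory Ser. A 51 (1989) 24–42. [PippengerSpencer1989]
* V. Rödl, *On a packing and covering problem*, European J. Combin. 6 (1985) 69–78. [Rodl1985]
-/

noncomputable section

open Finset

namespace Literature.Combinatorics.Hypergraph

namespace FGKMTCovering

variable {V ι : Type*} [Fintype V] [DecidableEq V]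

/-- A mass function on a finite type: nonnegative with total mass `1` (a finite probability law).
[cite: FordGreenKonyaginMaynardTao2018, §4.2 (random finite subsets)] -/
def IsLaw {α : Type*} [Fintype α] (μ : α → ℝ) : Prop :=
  (∀ a, 0 ≤ μ a) ∧ ∑ a, μ a = 1

/-- `P(v ∈ 𝐞)` for a random subset `𝐞 ⊆ V` with law `μ`. [cite: FordGreenKonyaginMaynardTao2018, (4.7)] -/
def probMem (μ : Finset V → ℝ) (v : V) : ℝ :=
  ∑ S ∈ (univ : Finset (Finset V)).filter (fun S => v ∈ S), μ S

/-- `P(v₁, v₂ ∈ 𝐞)` for a random subset `𝐞 ⊆ V` with law `μ`.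
[cite: FordGreenKonyaginMaynardTao2018, (4.8)] -/
def probPairMem (μ : Finset V → ℝ) (v₁ v₂ : V) : ℝ :=
  ∑ S ∈ (univ : Finset (Finset V)).filter (fun S => v₁ ∈ S ∧ v₂ ∈ S), μ S

/-- The normalized degree `d_I(v) := ∑_{i ∈ I} P(v ∈ 𝐞_i)` ((4.9)).
[cite: FordGreenKonyaginMaynardTao2018, (4.9)] -/
def normDegree (μ : ι → Finset V → ℝ) (I : Finset ι) (v : V) : ℝ :=
  ∑ i ∈ I, probMem (μ i) v

/-- The quantities `P_j(v)`: `P_0(v) := 1`, `P_{j+1}(v) := P_j(v) exp(−d_{I_{j+1}}(v)/P_j(v))`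
((4.10)–(4.11)). [cite: FordGreenKonyaginMaynardTao2018, (4.10)–(4.11)] -/
def levelProb (μ : ι → Finset V → ℝ) (I : ℕ → Finset ι) : ℕ → V → ℝ
  | 0, _ => 1
  | j + 1, v => levelProb μ I j v * Real.exp (-(normDegree μ (I (j + 1)) v / levelProb μ I j v))

/-- `P_j(e) := ∏_{v ∈ e} P_j(v)` ((4.14)). [cite: FordGreenKonyaginMaynardTao2018, (4.14)] -/
def levelProbSet (μ : ι → Finset V → ℝ) (I : ℕ → Finset ι) (j : ℕ) (e : Finset V) : ℝ :=
  ∏ v ∈ e, levelProb μ I j v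

/-- The event «`e ⊆ V ∖ ⋃_{j=1}^{J} ⋃_{i ∈ I_j} 𝐞'_i`» on a configuration `ω = (𝐞'_i)_i`
(reducible, so that it is decidable by instance search). [cite: FordGreenKonyaginMaynardTao2018, (4.13)] -/
abbrev AvoidsLevels (I : ℕ → Finset ι) (J : ℕ) (e : Finset V) (ω : ι → Finset V) : Prop :=
  ∀ v ∈ e, ∀ j ∈ Finset.Icc 1 J, ∀ i ∈ I j, v ∉ ω i

/-- The body of **Theorem 3** for a given constant `C₀`: «Let `D, r, A ≥ 1`, `0 < κ ≤ 1/2`, and let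
`m ≥ 0` be an integer. Let `δ > 0` satisfy the smallness bound (4.5)
`δ ≤ (κ^A/(C₀ exp(AD)))^{10^{m+2}}`. Let `I_1, …, I_m` be disjoint finite non-empty sets, and let `V`
be a finite set. For each `1 ≤ j ≤ m` and `i ∈ I_j`, let `𝐞_i` be a random finite subset of `V`.
Assume: (4.6) almost surely `#𝐞_i ≤ r`; (4.7) `P(v ∈ 𝐞_i) ≤ δ/(#I_j)^{1/2}`; (4.8)
`∑_{i ∈ I_j} P(v₁, v₂ ∈ 𝐞_i) ≤ δ` for distinct `v₁, v₂`; (4.12) `d_{I_j}(v) ≤ D P_{j−1}(v)`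
(`1 ≤ j ≤ m`) and (4.13) `P_j(v) ≥ κ` (`0 ≤ j ≤ m`). Then we can find random variables `𝐞'_i` with:
(a) the essential support of `𝐞'_i` is contained in the essential support of `𝐞_i`, union `{∅}`;
(b) for any `0 ≤ J ≤ m` and any finite `e ⊆ V` with `#e ≤ A − 2rJ`,
`P(e ⊆ V ∖ ⋃_{j ≤ J} ⋃_{i ∈ I_j} 𝐞'_i) = (1 + O_≤(δ^{1/10^{J+1}})) P_J(e)`.»
(Laws in place of random variables — see the module docstring.)
[cite: FordGreenKonyaginMaynardTao2018, Theorem 3] -/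
def Theorem3With (C₀ : ℝ) : Prop :=
  ∀ (V ι : Type) [Fintype V] [DecidableEq V] [Fintype ι] [DecidableEq ι]
    (D r A κ δ : ℝ) (m : ℕ) (I : ℕ → Finset ι) (μ : ι → Finset V → ℝ),
    1 ≤ D → 1 ≤ r → 1 ≤ A → 0 < κ → κ ≤ 1 / 2 → 0 < δ →
    δ ≤ (κ ^ A / (C₀ * Real.exp (A * D))) ^ (10 ^ (m + 2) : ℕ) →
    (∀ j ∈ Finset.Icc 1 m, (I j).Nonempty) →
    (∀ j₁ ∈ Finset.Icc 1 m, ∀ j₂ ∈ Finset.Icc 1 m, j₁ ≠ j₂ → Disjoint (I j₁) (I j₂)) →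
    (∀ j ∈ Finset.Icc 1 m, ∀ i ∈ I j, IsLaw (μ i)) →
    (∀ j ∈ Finset.Icc 1 m, ∀ i ∈ I j, ∀ S : Finset V, μ i S ≠ 0 → (S.card : ℝ) ≤ r) →
    (∀ j ∈ Finset.Icc 1 m, ∀ i ∈ I j, ∀ v : V,
        probMem (μ i) v ≤ δ / Real.sqrt ((I j).card : ℝ)) →
    (∀ j ∈ Finset.Icc 1 m, ∀ v₁ v₂ : V, v₁ ≠ v₂ → ∑ i ∈ I j, probPairMem (μ i) v₁ v₂ ≤ δ) →
    (∀ j ∈ Finset.Icc 1 m, ∀ v : V, normDegree μ (I j) v ≤ D * levelProb μ I (j - 1) v) →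
    (∀ j ≤ m, ∀ v : V, κ ≤ levelProb μ I j v) →
    ∃ Λ : (ι → Finset V) → ℝ, IsLaw Λ ∧
      (∀ ω, Λ ω ≠ 0 → ∀ j ∈ Finset.Icc 1 m, ∀ i ∈ I j, ω i = ∅ ∨ μ i (ω i) ≠ 0) ∧
      (∀ J ≤ m, ∀ e : Finset V, (e.card : ℝ) ≤ A - 2 * r * J →
        |(∑ ω ∈ (univ : Finset (ι → Finset V)).filter (fun ω => AvoidsLevels I J e ω), Λ ω)
            - levelProbSet μ I J e|
          ≤ δ ^ (1 / (10 : ℝ) ^ (J + 1)) * levelProbSet μ I J e)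

end FGKMTCovering

/-- **Ford–Green–Konyagin–Maynard–Tao 2018, Theorem 3 (Probabilistic covering).** «There exists a
constant `C₀ ≥ 1` such that the following holds» — the body being `FGKMTCovering.Theorem3With C₀`.
Named fact, not proved here (§5 of the paper, by induction on `m`; generalised Rödl nibble with
reweighting). [cite: FordGreenKonyaginMaynardTao2018, Theorem 3] -/
def FGKMT2018_theorem3 : Prop :=
  ∃ C₀ : ℝ, 1 ≤ C₀ ∧ FGKMTCovering.Theorem3With C₀

end Literature.Combinatorics.Hypergraph
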